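import Summits.BirchSwinnertonDyer.Rank1Residual.Additive.KatoDescentLocPKummerLogExistence
import Summits.BirchSwinnertonDyer.Rank1Residual.Additive.KatoDescentRankOneCountContraOfFinite
import Literature.NumberTheory.EllipticCurves.Kato2004.DescentCokernelFiniteOfRankLeOneProofs
import Literature.NumberTheory.EllipticCurves.Kato2004.LocPKernelRankOneProofs
import Mathlib.LinearAlgebra.Dimension.Localization
import Mathlib.LinearAlgebra.Dimension.Torsion.Finite
import HarnessLib

set_option autoImplicit false

/-!
# The base-level rank bound (R1) `rank_{ℤ_p} H¹(ℤ[1/p], T_pW) ≤ 1` in rank one with `Ш[p^∞]` finite, PROVED through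
# the Kummer-logarithm functional; conjunct (i) of stub 3 `stub_rankOneCountReadingKato` from Gross–Zagier–Kolyvagin
# ALONE; stub 3 of the Kato–Perrin-Riou skeletons v4 now rests on TWO named facts + TWO displays
# (seat `bsd-cm-prr-ty1` g9, cell `bsd-cm`; theorems only: no definition, no named fact, no instance, no `sorry`)

Part 8 of the seat's kernel cut of stub 3 of both registered skeletons (cruxes stmt-BirchSwinnertonDyer-19945
`…/Cruxes/EllipticUnitValueSevenOfGZK/Lines/kato_perrin_riou_zp.lean`, stmt-BirchSwinnertonDyer-19223
`…/Cruxes/CccOneLawOnTypeIstarZero/Lines/kato_perrin_riou_istar.lean`; = cell bsd-potss's held input 27322): after g7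
(`KatoDescentRankOneCountContraCut/OfFacts`, `KatoDescentKummerLogLinear`) and g8 (`KatoDescentLocPKummerLattice/Tower/
LogExistence`) the stub was `LocPKummer.rankOneCountReading_contra_of_facts_of_gzk` modulo THREE named facts {GZK,
`Kato2004.finite_descentCokernel_of_rankOne`, `IsNewformOf.level_eq_conductorNorm`} and TWO displays {PR-INV, COUNT}.
THIS FILE removes `Kato2004.finite_descentCokernel_of_rankOne` (cell bsd-cn100's reading (3.1′), «no `_holds` expected
soon (size L)») from that list, by PROVING — for `W` globally minimal — the base-level inequality (R1) that cn100's
`Kato2004/DescentCokernelFiniteOfRankLeOneProofs.lean` isolated as the whole content of the fact beyond (14.14.1)-injectivity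
and Thm. 12.4 (2), both of which a realised descent datum carries by itself.

## Mathematics (the global dimension count, Kato (14.9.3) ⊗ ℚ in rank one; planner note D430 of cell bsd-cm)

Write `A := H¹(ℤ[1/p], T_pW)` for the tree's `integralH1 (tateRep W p) p (κ.layerSubgroup 0)` (`ℤ_p`-module). Let
`W/ℚ` be globally minimal with a rational point `P₀` of infinite order.
* §1 `HasLocPKummerLog` is closed under sums (witness `(mn, n•Q + m•R)`: `locModPk`, the local Kummer map, `Point.map`
  and `log_ω` are additive); with g8's UNCONDITIONAL existence theorem `exists_hasLocPKummerLog_of_mem_integralH1` (one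
  Kummer logarithm for every integral class, from ONE point of infinite order) and g7's homogeneity
  `ContraCount.hasLocPKummerLog_smul_eq` this yields a `ℤ_p`-LINEAR functional `φ : A → ℚ_p` with
  `HasLocPKummerLog (x) (φ x)` for every `x ∈ A` — «`log_ω ∘ loc_p : H¹(ℤ[1/p], T_pW) → H¹_f(ℚ_p, V_pW) → ℚ_p`»
  (Bloch–Kato Ex. 3.11) in the tree's finite-level currency (`exists_kummerLog_linearMap`).
* §2 If `rank_ℤ W(ℚ) = 1` and `Ш(W)[p^∞]` is finite, `ker φ` is `ℤ_p`-TORSION: `φ x = 0` means the Kummer witness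
  point has `log_ω = 0`, hence is torsion (AEC IV.6.4; cn100's
  `exists_forall_locModPk_nsmul_eq_zero_of_hasLocPKummerLog_zero`), so `loc_p(N·x) ≡ 0` at every level `p^k`, and
  cn100's DISCHARGED reading (3.1″) `Kato2004.locP_kernel_isTorsion_of_rankOne_holds` (Kato (14.9.3) + §14.1 in rank one:
  `loc_p` has torsion kernel on `H¹(ℤ[1/p], T_pW)`) gives `p^j·N·x = 0`. Rank–nullity over the domain `ℤ_p`
  (`LinearMap.rank_range_add_rank_ker`), `rank (torsion) = 0` and `rank_{ℤ_p} ℚ_p = 1` give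
  **(R1) `Module.rank ℤ_[p] A ≤ 1`** (`rank_integralH1_le_one`) — the displayed hypothesis `hR1` of cn100's
  `Kato2004.finite_descentCokernel_of_rankOne_of_rank_le_one`, at globally minimal `W`.
* §3 Consequences on pins (cn100's pin-level theorem `IwasawaH1Data.finite_descentCokernel_of_rank_le_one`: (α) + `𝐇¹_Γ`
  finitely generated, torsion free, non-zero + (R1) ⟹ the descent cokernel `A / proj₀(𝐇¹_Γ/T)` is finite): for every
  descent PACKAGE `J : IwasawaH2Data W p κ γ I` ((α) = `J.proj_zero_eq_zero_iff_mem_TSubmodule`) over a pin whose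
  `I.H` is finitely generated, torsion free and non-trivial, `Finite I.descentCokernel` and `Finite (coinvariants p J.H2)`
  (`= #𝐇²_Γ/T < ∞`, (14.14.1) + the `lengthAt` calculus, cn100's `finite_descentCokernel_iff_finite_coinvariants_H2`); for
  every v2 pin `P : KatoDescentDatumPinH2 W p D` of an abstract Kato descent datum `D` (which CARRIES `D.H` finitely
  generated, torsion free, `D.z ≠ 0`, transported along `P.eH`), `Finite (coinvariants p D.H2)`; hence CONJUNCT (i) of
  stub 3 hypothesis-shaped from Gross–Zagier–Kolyvagin alone (`rankOneCountReading_finite_of_gzk`: `r_an = 1 ⇒ rank = 1`,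
  `Ш` finite given), for the contragredient closed binder `IsKatoZetaDescentDatumOfContra` and for the v2-keyed
  `IsKatoZetaDescentDatumOf` alike (only the pin is used).
* §4 `rankOneCountReading_contra_of_gzk hGZK hlev hPRinv hCount` = THE WHOLE STUB (verbatim type) from TWO named facts
  {GZK `rank_eq_analyticRank_of_analyticRank_le_one`, `IsNewformOf.level_eq_conductorNorm`} and TWO displays {PR-INV (6),
  COUNT (7)} — through the general form `ContraCount.rankOneCountReading_contra_of_finite` of g7's reduction
  (`KatoDescentRankOneCountContraOfFinite.lean`, this seat g9: g7's proof with conjunct (i) displayed instead of `hfd`).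
  RESIDUAL OF STUB 3 after this file = {GZK, `IsNewformOf.level_eq_conductorNorm`} + {PR-INV, COUNT}.

(R1) is also the first brick of the display COUNT (7) («`A = H¹(ℤ[1/p],T) ≅ ℤ_p`» on the rows: rank `≤ 1` here; rank
`≥ 1` from (α) on any pin, cn100's `exists_proj_zero_not_isOfFinAddOrder`; torsion-freeness when `W(ℚ)[p] = 0` is not
addressed here). BY-PRODUCT for cell bsd-cn100 (lines `kato-zeta-perrin-riou` on stmt-…-19080 / -19160, conjunct 9 of
`stub_refereedInputs`): at globally minimal `W` their fact `finite_descentCokernel_of_rankOne` holds on every pin that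
admits a package and has `𝐇¹_Γ` f.g. torsion-free non-zero (e.g. under `nonempty_iwasawaH2Data ∧ thm12_4`), with no
(R1) display left (`finite_descentCokernel_of_thm12_4_of_nonempty`).

HONEST LABEL: theorems only; conditional reductions on displayed hypotheses where stated; no stub or item is closed;
nothing is registered; nothing is asserted on 19945 / 19223; Kato's Main Conjecture and Perrin-Riou's conjecture are not
touched; BSD is not proved for any curve. Not proved here: the named fact `Kato2004.finite_descentCokernel_of_rankOne`
itself (all `W`, all pins: needs (α) and 12.4 (2) for an arbitrary pin and a model transport to non-minimal `W`).

References: [Kato2004Asterisque] §14.1 (p. 235), §14.9 (14.9.3) (p. 240), §14.14 (14.14.1)–(14.14.2) (p. 243),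
Thm. 12.4 (2) (p. 221); [BlochKato1990] Def. 3.10, Ex. 3.11; [AlpogeBhargavaShnidman2022] App. A §10.1.2–10.1.3
(pp. 33–34); [GreenbergLNM1716] §1 (p. 61); [SilvermanAEC2009] IV.6.4, VII.6.3, VIII.§2; [Darmon2004] Thm. 3.22.
-/

noncomputable section

open scoped Classical NumberField

open WeierstrassCurve Field IsDedekindDomain Literature.NumberTheory.EllipticCurves
  Literature.NumberTheory.EllipticCurves.Kato2004 Literature.NumberTheory.EllipticCurves.IwasawaAlgebra
  Literature.NumberTheory.EllipticCurves.Kato2004.EulerSystemValues Literature.NumberTheory.GaloisRepresentations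
  Literature.NumberTheory.EllipticCurves.ModularForms Literature.NumberTheory.EllipticCurves.Rank1Residual
open Summit.BirchSwinnertonDyer.BirchSwinnertonDyer.Theorems.CongruentShaFreeCutKatoDescentDatumOfH2
  Summit.BirchSwinnertonDyer.BirchSwinnertonDyer.Theorems.CongruentShaFreeCutKatoKummerLogTorsion

namespace Summit.BirchSwinnertonDyer.Rank1Residual.Additive.LocPKummer

/-! ## §1 `HasLocPKummerLog` is additive; the Kummer-logarithm functional on `H¹(ℤ[1/p], T_pW)` -/

section Functional

variable (W : WeierstrassCurve ℚ) [W.IsElliptic] [W.IsGloballyMinimal] (p : ℕ) [Fact p.Prime]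
  [ContinuousSMul ℤ_[p] (W.tateModule p)]

/-- The zero class has Kummer logarithm `0` (witness `(1, 0)`). [cite: BlochKato1990, Def. 3.10 and Ex. 3.11] -/
theorem hasLocPKummerLog_zero : HasLocPKummerLog W p (0 : H1 (tateRep W p) ⊤) 0 := by
  refine ⟨1, 0, one_ne_zero, fun k ↦ ?_, ?_⟩
  · rw [nsmul_zero, map_zero, map_zero, map_zero]
  · rw [mul_zero, padicLogLocal_eq_padicLog, map_zero]

/-- **`HasLocPKummerLog` is closed under sums**: `log loc_p x = s`, `log loc_p y = t` ⟹ `log loc_p (x + y) = s + t`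
(witnesses `(m, Q)`, `(n, R)` ↦ `(mn, n•Q + m•R)`: `locModPk`, the local Kummer map `κ_k`, `E(ℚ_p) → E(ℚ_v)` and `log_ω`
are additive). [cite: BlochKato1990, Def. 3.10 and Ex. 3.11] [cite: SilvermanAEC2009, VIII.§2 and IV.6.4] -/
theorem hasLocPKummerLog_add {x y : H1 (tateRep W p) ⊤} {s t : ℚ_[p]}
    (hx : HasLocPKummerLog W p x s) (hy : HasLocPKummerLog W p y t) :
    HasLocPKummerLog W p (x + y) (s + t) := by
  obtain ⟨m, Q, hm, hkx, hlogQ⟩ := hx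
  obtain ⟨n, R, hn, hky, hlogR⟩ := hy
  refine ⟨m * n, n • Q + m • R, Nat.mul_ne_zero hm hn, fun k ↦ ?_, ?_⟩
  · have h1 : (m * n) • (x + y) = n • (m • x) + m • (n • y) := by
      rw [nsmul_add, mul_nsmul, mul_nsmul']
    simp only [h1, map_add, map_nsmul, hkx k, hky k]
  · simp only [padicLogLocal_eq_padicLog, map_add, map_nsmul, nsmul_eq_mul] at hlogQ hlogR ⊢
    rw [hlogQ, hlogR]
    push_cast
    ring

/-- **The Kummer-logarithm functional** «`log_ω ∘ loc_p : H¹(ℤ[1/p], T_pW) → ℚ_p`» (Bloch–Kato Ex. 3.11; Kato (14.9.3)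
⊗ ℚ in positive rank): for `W/ℚ` globally minimal with a point `P₀ ∈ W(ℚ)` of infinite order, every prime `p` and every
`ℤ_p`-extension datum `κ` (bottom layer), there is a `ℤ_p`-LINEAR map `φ` on `A = integralH1 (tateRep W p) p (κ.layerSubgroup 0)`
with `HasLocPKummerLog W p (layerZeroToTop x) (φ x)` for every `x ∈ A` — existence by g8's
`exists_hasLocPKummerLog_of_mem_integralH1` (unconditional), single-valuedness and homogeneity by g7's
`ContraCount.hasLocPKummerLog_smul_eq`, additivity by `hasLocPKummerLog_add`.
[cite: BlochKato1990, Def. 3.10 and Ex. 3.11] [cite: Kato2004Asterisque, §14.9 (14.9.3) (p. 240)]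
[cite: AlpogeBhargavaShnidman2022, App. A §10.1.2 (p. 33)] -/
theorem exists_kummerLog_linearMap (κ : ZpExtension ℚ p) {P₀ : W.toAffine.Point} (hP₀ : ¬ IsOfFinAddOrder P₀) :
    ∃ φ : integralH1 (tateRep W p) p (κ.layerSubgroup 0) →ₗ[ℤ_[p]] ℚ_[p],
      ∀ x : integralH1 (tateRep W p) p (κ.layerSubgroup 0),
        HasLocPKummerLog W p (layerZeroToTop W p κ (x : H1 (tateRep W p) (κ.layerSubgroup 0))) (φ x) := by
  have hex : ∀ x : integralH1 (tateRep W p) p (κ.layerSubgroup 0),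
      ∃ t : ℚ_[p], HasLocPKummerLog W p (layerZeroToTop W p κ (x : H1 (tateRep W p) (κ.layerSubgroup 0))) t :=
    fun x ↦ exists_hasLocPKummerLog_of_mem_integralH1 W p (layerZeroToTop_mem_integralH1 W p κ x.2) hP₀
  choose f hf using hex
  refine ⟨{ toFun := f, map_add' := fun x y ↦ ?_, map_smul' := fun c x ↦ ?_ }, hf⟩
  · have h := hasLocPKummerLog_add W p (hf x) (hf y)
    rw [← map_add, ← Submodule.coe_add] at h
    exact ContraCount.HasLocPKummerLog.unique W p (hf (x + y)) h
  · have h := ContraCount.hasLocPKummerLog_smul_eq W p (c₁ := 1) (c₂ := c)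
      (x := layerZeroToTop W p κ ((c • x : integralH1 (tateRep W p) p (κ.layerSubgroup 0)) :
        H1 (tateRep W p) (κ.layerSubgroup 0)))
      (y := layerZeroToTop W p κ (x : H1 (tateRep W p) (κ.layerSubgroup 0)))
      (by rw [one_smul, Submodule.coe_smul, map_smul]) (hf (c • x)) (hf x)
    rw [PadicInt.coe_one, one_mul] at h
    rw [h, RingHom.id_apply, Algebra.smul_def]
    rfl

end Functional

/-! ## §2 (R1): `rank_{ℤ_p} H¹(ℤ[1/p], T_pW) ≤ 1` in rank one with `Ш[p^∞]` finite -/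

section RankBound

variable (W : WeierstrassCurve ℚ) [W.IsElliptic] [W.IsGloballyMinimal] (p : ℕ) [Fact p.Prime]
  [ContinuousSMul ℤ_[p] (W.tateModule p)]

/-- **A class with Kummer logarithm `0` is `ℤ_p`-torsion** (rank one, `Ш[p^∞]` finite): `HasLocPKummerLog (x) 0` ⟹ the
witness point is torsion ⟹ `loc_p(N·x) ≡ 0 (mod p^k)` for all `k` (`exists_forall_locModPk_nsmul_eq_zero_of_hasLocPKummerLog_zero`)
⟹ `p^j·N·x = 0` by cn100's DISCHARGED reading (3.1″) `Kato2004.locP_kernel_isTorsion_of_rankOne_holds` (Kato (14.9.3) +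
§14.1: `loc_p` has torsion kernel on `H¹(ℤ[1/p], T_pW)` in rank one). [cite: Kato2004Asterisque, §14.9 (14.9.3) (p. 240) and §14.1 (p. 235)]
[cite: AlpogeBhargavaShnidman2022, App. A §10.1.3 (p. 34)] [cite: SilvermanAEC2009, IV.6.4 and VII.6.3] -/
theorem exists_smul_eq_zero_of_hasLocPKummerLog_zero (κ : ZpExtension ℚ p) (hrank : W.mordellWeilRank = 1)
    (hsha : Finite (AddCommGroup.primaryComponent W.sha p))
    {x : H1 (tateRep W p) (κ.layerSubgroup 0)} (hx : x ∈ integralH1 (tateRep W p) p (κ.layerSubgroup 0))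
    (h0 : HasLocPKummerLog W p (layerZeroToTop W p κ x) 0) :
    ∃ a : ℤ_[p], a ≠ 0 ∧ a • x = 0 := by
  have hp : p.Prime := Fact.out
  obtain ⟨N, hN, hk⟩ := exists_forall_locModPk_nsmul_eq_zero_of_hasLocPKummerLog_zero W p _ h0
  obtain ⟨j, hj⟩ := locP_kernel_isTorsion_of_rankOne_holds W p κ (N • x)
    ((integralH1 (tateRep W p) p (κ.layerSubgroup 0)).nsmul_mem hx N) hrank hsha
    (fun k ↦ by rw [map_nsmul]; exact hk k)
  refine ⟨(p : ℤ_[p]) ^ j * (N : ℤ_[p]), mul_ne_zero (pow_ne_zero _ (Nat.cast_ne_zero.mpr hp.ne_zero))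
    (Nat.cast_ne_zero.mpr hN), ?_⟩
  rw [mul_smul, Nat.cast_smul_eq_nsmul, hj]

/-- `rank_{ℤ_p} ℚ_p = 1` (`ℚ_p = Frac ℤ_p`). [folklore] -/
private theorem rank_padic_eq_one : Module.rank ℤ_[p] ℚ_[p] = 1 := by
  rw [← IsLocalization.rank_eq ℚ_[p] (nonZeroDivisors ℤ_[p]) le_rfl, Module.rank_self]

/-- **(R1) `rank_{ℤ_p} H¹(ℤ[1/p], T_pW) ≤ 1`** for `W/ℚ` globally minimal of Mordell–Weil rank `1` with `Ш(W)[p^∞]`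
finite, at the bottom layer of any `ℤ_p`-extension datum `κ` — verbatim (at globally minimal `W`) the displayed
hypothesis `hR1` of cn100's `Kato2004.finite_descentCokernel_of_rankOne_of_rank_le_one`. Proof: the Kummer-logarithm
functional `φ : A →ₗ[ℤ_p] ℚ_p` (§1) has torsion kernel (`exists_smul_eq_zero_of_hasLocPKummerLog_zero`), so
`rank A = rank (range φ) + rank (ker φ) ≤ rank_{ℤ_p} ℚ_p + 0 = 1` (rank–nullity over the domain `ℤ_p`). This is Kato's
(14.9.3) ⊗ ℚ in rank one: `H¹(ℤ[1/p], V_pW) ↪ H¹_f(ℚ_p, V_pW) →(log) ℚ_p`.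
[cite: Kato2004Asterisque, §14.9 (14.9.3) (p. 240), §14.1 (p. 235) and §14.14 (14.14.1) (p. 243)]
[cite: BlochKato1990, Ex. 3.11] [cite: AlpogeBhargavaShnidman2022, App. A §10.1.2–10.1.3 (pp. 33–34)] -/
theorem rank_integralH1_le_one (κ : ZpExtension ℚ p) (hrank : W.mordellWeilRank = 1)
    (hsha : Finite (AddCommGroup.primaryComponent W.sha p)) :
    Module.rank ℤ_[p] (integralH1 (tateRep W p) p (κ.layerSubgroup 0)) ≤ 1 := by
  obtain ⟨P₀, hP₀⟩ := WeierstrassCurve.exists_not_isOfFinAddOrder_of_mordellWeilRank_ne_zero W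
    (by rw [hrank]; exact one_ne_zero)
  obtain ⟨φ, hφ⟩ := exists_kummerLog_linearMap W p κ hP₀
  have hker : Module.IsTorsion ℤ_[p] (LinearMap.ker φ) := by
    intro y
    have hy0 : HasLocPKummerLog W p
        (layerZeroToTop W p κ ((y : integralH1 (tateRep W p) p (κ.layerSubgroup 0)) :
          H1 (tateRep W p) (κ.layerSubgroup 0))) 0 := by
      have h := hφ y
      rwa [LinearMap.mem_ker.mp y.2] at h
    obtain ⟨a, ha, hay⟩ := exists_smul_eq_zero_of_hasLocPKummerLog_zero W p κ hrank hsha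
      (y : integralH1 (tateRep W p) p (κ.layerSubgroup 0)).2 hy0
    refine ⟨⟨a, mem_nonZeroDivisors_of_ne_zero ha⟩, ?_⟩
    apply Subtype.ext; apply Subtype.ext
    change a • ((y : integralH1 (tateRep W p) p (κ.layerSubgroup 0)) : H1 (tateRep W p) (κ.layerSubgroup 0)) = 0
    exact hay
  have h0 : Module.rank ℤ_[p] (LinearMap.ker φ) = 0 := rank_eq_zero_iff_isTorsion.mpr hker
  have h1 : Module.rank ℤ_[p] (LinearMap.range φ) ≤ 1 :=
    (Submodule.rank_le (LinearMap.range φ)).trans (rank_padic_eq_one p).le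
  rw [← LinearMap.rank_range_add_rank_ker φ, h0, add_zero]
  exact h1

end RankBound

/-! ## §3 Consequences on pins: the descent cokernel and `𝐇²_Γ/T` are finite; conjunct (i) of stub 3 from GZK alone -/

section Descent

variable (W : WeierstrassCurve ℚ) [W.IsElliptic] [W.IsGloballyMinimal] (p : ℕ) [Fact p.Prime]
  [ContinuousSMul ℤ_[p] (W.tateModule p)] {κ : ZpExtension ℚ p} {γ : absoluteGaloisGroup ℚ}

/-- **The descent cokernel `H¹(ℤ[1/p], T_pW) / proj₀(𝐇¹_Γ/T)` is finite** on every pin `I` that admits a descent PACKAGE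
`J : IwasawaH2Data W p κ γ I` ((α) on the pin) and whose `𝐇¹_Γ = I.H` is finitely generated, torsion free and non-zero
(Kato (12.2.1), Thm. 12.4 (2)), for `W` globally minimal of rank `1` with `Ш[p^∞]` finite — cn100's pin-level
`IwasawaH1Data.finite_descentCokernel_of_rank_le_one` fed with (R1). `κ` need not be cyclotomic here.
[cite: Kato2004Asterisque, §14.14 (14.14.1) (p. 243), Thm. 12.4 (2) (p. 221), §14.9 (14.9.3) (p. 240)]
[cite: GreenbergLNM1716, §1 (p. 61)] -/
theorem finite_descentCokernel_of_iwasawaH2Data {I : IwasawaH1Data W p κ γ} (J : IwasawaH2Data W p κ γ I)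
    [Module.Finite (IwasawaAlgebra p) I.H] [Module.IsTorsionFree (IwasawaAlgebra p) I.H] [Nontrivial I.H]
    (hrank : W.mordellWeilRank = 1) (hsha : Finite (AddCommGroup.primaryComponent W.sha p)) :
    Finite I.descentCokernel :=
  I.finite_descentCokernel_of_rank_le_one (fun x hx ↦ (J.proj_zero_eq_zero_iff_mem_TSubmodule x).mp hx)
    (rank_integralH1_le_one W p κ hrank hsha)

/-- **`𝐇²_Γ/T·𝐇²_Γ` is finite on every such package** (`finite_descentCokernel_iff_finite_coinvariants_H2`: (14.14.1) on the
pin + the `lengthAt` calculus for the finitely generated torsion `J.H2`) — the conclusion of cn100's consumer form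
`IwasawaH2Data.finite_coinvariants_H2_of_rankOne` WITHOUT the named fact, at globally minimal `W`, on pins with `𝐇¹_Γ`
f.g. torsion-free non-zero. [cite: Kato2004Asterisque, §14.14 (14.14.1)–(14.14.2) (p. 243), Thm. 12.4 (1)(2) (p. 221)] -/
theorem finite_coinvariants_H2_of_iwasawaH2Data {I : IwasawaH1Data W p κ γ} (J : IwasawaH2Data W p κ γ I)
    [Module.Finite (IwasawaAlgebra p) I.H] [Module.IsTorsionFree (IwasawaAlgebra p) I.H] [Nontrivial I.H]
    (hrank : W.mordellWeilRank = 1) (hsha : Finite (AddCommGroup.primaryComponent W.sha p)) :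
    Finite (coinvariants p J.H2) :=
  J.finite_descentCokernel_iff_finite_coinvariants_H2.mp (finite_descentCokernel_of_iwasawaH2Data W p J hrank hsha)

/-- **On a v2 pin of an abstract Kato descent datum `D`, `(D.H2)_Γ` is finite** (rank one, `Ш[p^∞]` finite, `W` globally
minimal): `D` carries `D.H` finitely generated and torsion free with `D.z ≠ 0` (its own axioms, Kato Thm. 12.4 (2) /
12.5 (4)), transported to `P.I.H` along `P.eH`; the package is `P.J`; the conclusion moves back along `P.eH2`. No (H2)
clause, no admissibility, no cyclotomicity is used — only the pin.
[cite: Kato2004Asterisque, Thm. 12.4 (p. 221) and §14.14 (14.14.1)–(14.14.2) (p. 243)] -/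
theorem finite_coinvariants_H2_of_pin {D : KatoDescentDatum p} (P : KatoDescentDatumPinH2 W p D)
    (hrank : W.mordellWeilRank = 1) (hsha : Finite (AddCommGroup.primaryComponent W.sha p)) :
    Finite (coinvariants p D.H2) := by
  haveI : Module.Finite (IwasawaAlgebra p) P.I.H := Module.Finite.equiv P.eH
  haveI : NoZeroSMulDivisors (IwasawaAlgebra p) P.I.H :=
    P.eH.symm.injective.noZeroSMulDivisors _ (map_zero _) (fun c x ↦ map_smul _ c x)
  haveI : Nontrivial D.H := nontrivial_of_ne D.z 0 D.z_ne_zero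
  haveI : Nontrivial P.I.H := P.eH.injective.nontrivial
  haveI := finite_coinvariants_H2_of_iwasawaH2Data W p P.J hrank hsha
  exact Finite.of_equiv _ (coinvariantsEquiv P.eH2).toEquiv.symm

omit [W.IsGloballyMinimal] in
/-- **cn100's fact `finite_descentCokernel_of_rankOne` at globally minimal `W`, from `nonempty_iwasawaH2Data` and
`thm12_4` with NO (R1) display** (by-product for the lines `kato-zeta-perrin-riou` of cell bsd-cn100: conjunct 9 of
`stub_refereedInputs` costs, at a globally minimal curve, exactly conjuncts 7 and (12.2.1)/12.4 (2)).
[cite: Kato2004Asterisque, §14.14 (14.14.1) (p. 243), Thm. 12.4 (2) (p. 221), §14.9 (14.9.3) (p. 240)] -/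
theorem finite_descentCokernel_of_thm12_4_of_nonempty [W.IsGloballyMinimal] (h2 : nonempty_iwasawaH2Data)
    (h12 : thm12_4) (hκ : κ.IsCyclotomic) (hγ : κ.IsTopGenerator γ) (I : IwasawaH1Data W p κ γ)
    (hrank : W.mordellWeilRank = 1) (hsha : Finite (AddCommGroup.primaryComponent W.sha p)) :
    Finite I.descentCokernel := by
  obtain ⟨hfg, ⟨htf, hrk⟩, -⟩ := h12 W p κ γ hκ hγ I
  haveI := hfg
  haveI := htf
  haveI : Nontrivial I.H := by
    by_contra hnt
    rw [not_nontrivial_iff_subsingleton] at hnt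
    have h0 : Module.rank (IwasawaAlgebra p) I.H = 0 := rank_subsingleton' _ _
    rw [hrk] at h0
    exact one_ne_zero h0
  obtain ⟨J⟩ := h2 W p κ γ hκ hγ I
  exact finite_descentCokernel_of_iwasawaH2Data W p J hrank hsha

end Descent

section ConjunctOne

/-- **CONJUNCT (i) OF STUB 3 FROM GROSS–ZAGIER–KOLYVAGIN ALONE**, hypothesis-shaped exactly as g7's
`ContraCount.rankOneCountReading_finite_of_gzk_of_finite_descentCokernel hGZK hfd` (= the `hfin` of
`ContraCount.rankOneCountReading_contra_of_finite`) but WITHOUT `Kato2004.finite_descentCokernel_of_rankOne`: for `W`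
globally minimal of analytic rank `1` with `Ш(W)` finite and a datum `D` with `IsKatoZetaDescentDatumOfContra W p D`,
`(D.H2)_Γ` is finite (`r_an ≤ 1 ⇒ rank = r_an`; §3 on the pin). [cite: Darmon2004, Thm. 3.22]
[cite: Kato2004Asterisque, §14.14 (14.14.1)–(14.14.2) (p. 243) and §14.9 (14.9.3) (p. 240)] -/
theorem rankOneCountReading_finite_of_gzk (hGZK : rank_eq_analyticRank_of_analyticRank_le_one) :
    ∀ (W : WeierstrassCurve ℚ) [W.IsElliptic] [W.IsGloballyMinimal] (p : ℕ) [Fact p.Prime]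
      (D : KatoDescentDatum p), W.analyticRank = 1 → Finite W.sha → IsKatoZetaDescentDatumOfContra W p D →
        Finite (coinvariants p D.H2) := by
  intro W _ _ p _ D hr hfin hD
  letI : ContinuousSMul ℤ_[p] (W.tateModule p) := TateModule.continuousSMul_padicInt
  obtain ⟨hmw, -⟩ := hGZK W (by rw [hr])
  obtain ⟨P, -, -⟩ := hD
  haveI := hfin
  exact finite_coinvariants_H2_of_pin W p P (by rw [hmw, hr])
    (inferInstance : Finite (AddCommGroup.primaryComponent W.sha p))

/-- The same for the v2-keyed closed binder `IsKatoZetaDescentDatumOf` (cell bsd-potss's original key; only the pin is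
used, so the key is immaterial). [cite: Darmon2004, Thm. 3.22] [cite: Kato2004Asterisque, §14.14 (14.14.1)–(14.14.2) (p. 243)] -/
theorem rankOneCountReading_finite_of_gzk_v2 (hGZK : rank_eq_analyticRank_of_analyticRank_le_one) :
    ∀ (W : WeierstrassCurve ℚ) [W.IsElliptic] [W.IsGloballyMinimal] (p : ℕ) [Fact p.Prime]
      (D : KatoDescentDatum p), W.analyticRank = 1 → Finite W.sha → IsKatoZetaDescentDatumOf W p D →
        Finite (coinvariants p D.H2) := by
  intro W _ _ p _ D hr hfin hD
  letI : ContinuousSMul ℤ_[p] (W.tateModule p) := TateModule.continuousSMul_padicInt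
  obtain ⟨hmw, -⟩ := hGZK W (by rw [hr])
  obtain ⟨P, -, -⟩ := hD
  haveI := hfin
  exact finite_coinvariants_H2_of_pin W p P (by rw [hmw, hr])
    (inferInstance : Finite (AddCommGroup.primaryComponent W.sha p))

end ConjunctOne

/-! ## §4 Stub 3 from TWO named facts and TWO displayed schemata -/

section Stub

/-- **STUB 3 `stub_rankOneCountReadingKato` from TWO named facts and TWO displays**: `TorsionFree.RankOneCountReading
IsKatoZetaDescentDatumOfContra Kato2004.PRRatio` (verbatim the stub's type in both v4 skeletons) from Gross–Zagier–Kolyvagin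
(`rank_eq_analyticRank_of_analyticRank_le_one`), `IsNewformOf.level_eq_conductorNorm`, and the displayed schemata PR-INV
(6) and COUNT (7) of `KatoDescentRankOneCountContraOfFacts.lean` — conjunct (i) (this file, §3), LOG-EX (4)
(`logEx_of_gzk`) and LOG-HOM (5) (`ContraCount.logHom_display`) being theorems. Conditional reduction; closes nothing by
itself. RESIDUAL OF STUB 3 = {GZK, `IsNewformOf.level_eq_conductorNorm`} + {PR-INV, COUNT}.
[cite: Kato2004Asterisque, §13.9–13.12 (pp. 229–231), §14.9 (14.9.3) (p. 240), §14.14 (p. 243) and Prop. 14.16 (p. 244)]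
[cite: BlochKato1990, Def. 3.10 and Ex. 3.11] [cite: BurnsKuriharaSano2019, Thm. 7.3 and Thm. 7.8 (d)] [cite: Darmon2004, Thm. 3.22] -/
theorem rankOneCountReading_contra_of_gzk
    (hGZK : rank_eq_analyticRank_of_analyticRank_le_one)
    (hlev : ∀ (N : ℕ) [NeZero N], IsNewformOf.level_eq_conductorNorm (N := N))
    (hPRinv : ∀ (W : WeierstrassCurve ℚ) [W.IsElliptic] [W.IsGloballyMinimal] (p : ℕ) [Fact p.Prime]
      (ℒ₁ ℒ₂ : ℚ_[p]), Kato2004.PRRatio W p ℒ₁ → Kato2004.PRRatio W p ℒ₂ → ∃ w : ℚ_[p], ‖w‖ = 1 ∧ ℒ₂ = w * ℒ₁)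
    (hCount : ∀ (W : WeierstrassCurve ℚ) [W.IsElliptic] [W.IsGloballyMinimal] (p : ℕ) [Fact p.Prime],
      letI : ContinuousSMul ℤ_[p] (W.tateModule p) := TateModule.continuousSMul_padicInt
      ∀ (κ : ZpExtension ℚ p) (γ : absoluteGaloisGroup ℚ), κ.IsCyclotomic → κ.IsTopGenerator γ →
        ∀ (I : IwasawaH1Data W p κ γ) (J : IwasawaH2Data W p κ γ I) (x : I.H) (s : ℚ_[p])
          (P : W.toAffine.Point),
          W.analyticRank = 1 → p ≠ 2 → Addv W p → 0 ≤ padicValRat p W.j → ¬ p ∣ W.torsionOrder →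
          Finite W.sha →
          (∀ (Y : W.FineSelmerDualData κ γ⁻¹) (𝔮 : PrimeSpectrum (IwasawaAlgebra p)), 𝔮.asIdeal.height = 1 →
            Module.lengthAt (IwasawaAlgebra p) J.H2 𝔮 = Module.lengthAt (IwasawaAlgebra p) Y.X 𝔮) →
          (∀ Q : W.toAffine.Point, ∃ n : ℤ, IsOfFinAddOrder (Q - n • P)) →
          HasLocPKummerLog W p (layerZeroToTop W p κ (I.proj 0 x)) s →
          (s ≠ 0 ↔ Nat.card (J.A ⧸ (IwasawaAlgebra p) ∙ J.ι (Submodule.Quotient.mk x)) ≠ 0) ∧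
            ∀ m : ℕ, Nat.card (J.A ⧸ (IwasawaAlgebra p) ∙ J.ι (Submodule.Quotient.mk x)) =
                p ^ m * Nat.card (coinvariants p J.H2) →
              s.valuation = (m : ℤ) + padicValNat p (Nat.card (AddCommGroup.primaryComponent W.sha p)) +
                padicValNat p W.tamagawaProduct +
                2 * (padicLogLocal W p
                  (WeierstrassCurve.Affine.Point.map (W' := W.toAffine) (S := ℚ) (Algebra.ofId ℚ ℚ_[p]) P)).valuation) :
    TorsionFree.RankOneCountReading IsKatoZetaDescentDatumOfContra Kato2004.PRRatio :=
  ContraCount.rankOneCountReading_contra_of_finite hGZK (rankOneCountReading_finite_of_gzk hGZK) hlev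
    (logEx_of_gzk hGZK) ContraCount.logHom_display hPRinv hCount

end Stub

end Summit.BirchSwinnertonDyer.Rank1Residual.Additive.LocPKummer

end
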